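import Summits.BirchSwinnertonDyer.BirchSwinnertonDyer.Theses.PrintX8VSC
import Summits.BirchSwinnertonDyer.BirchSwinnertonDyer.Theorems.PrintX8SharpFlatRankZeroRoadContra
import Literature.NumberTheory.EllipticCurves.BurungaleKobayashiOta2024.RankOnePPartOfSharpFlatMainConjectureContra
import HarnessLib

/-!
# Route `PrintX8VSC` (print-keyed repair twin of `PrintX8VS`; born 2026-08-28T22:36Z), item stmt-BirchSwinnertonDyer-23745
# `RankOneLinkOfPrintX8Contra` MODULO ITS ONE NAMED PUBLISHED FACT — the print-keyed ♯/♭ reading of Burungale–Kobayashi–Ota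
# App. A Cor. A.5 (`BurungaleKobayashiOta2024.corA5_pPart_of_sharpFlatCharIdeal_eq_contra`, typed by the INPUTS desk, statement only)

Cell `bsd-ssimc`, width seat `cruxlead-stmt-BirchSwinnertonDyer-19875-w3` (gen 10) under the 19875 LEAD; `--supports`
stmt-BirchSwinnertonDyer-23745 `--as helper` (CONDITIONAL result: the item as born has antecedents `PublishedInputsX8Contra →
RankEqAnalyticRankLeOne → SharpFlatMainConjectureX8Contra` only and its content is a published theorem not proved in the tree, so it
closes only after the planner's announced route edit «(held print-keyed BKO fact) + glue»; this file is that glue with the fact as an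
explicit hypothesis). The print-keyed twin of `Theorems/PrintX8SharpFlatLinks.lean` §1–§2 (route `PrintX8`, γ-keyed BKO fact).
HONEST FRAMING: plumbing; Cor. A.5, the main conjecture, leaf X8 and BSD are NOT proved here.

* §1 `X8.bsdp_of_sprungSharpFlatMainConjectureContra_of_corA5Contra_of_analyticRank_eq_one` — per pair, analytic rank `1`, any image:
  the print-keyed main-conjecture body at `(W, 3)` (all admissible colours) ⟹ `BSDp W 3`, granted the print-keyed Cor. A.5 fact,
  BCDT (`exists_isNewformOf`), GZK, `hasEntireLFunction_rat`; the admissible colour displayed by the desk's per-pair reading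
  `BurungaleKobayashiOta2024.X8.bsdp_of_corA5_sharpFlat_contra` is DISCHARGED (newform, `3 ∤ N`, Sprung pair of Sprung 2017 Thm. 1.12,
  a colour with `L^• ≠ 0` by Prop. 6.14).
* §2 `rankOneLinkOfPrintX8Contra_of_corA5Contra (hBKO) : PrintX8VSC.RankOneLinkOfPrintX8Contra` — the route decl modulo the fact.

References: [BurungaleKobayashiOta2023] App. A Cor. A.5; [Sprung2012] Prop. 6.14 (p. 1498), Prop. 7.19, Main Conj. 7.21 (p. 1505), §7.5;
[Sprung2017] Thm. 1.12; [Kobayashi2013] Cor. 1.3 (iii); [Miller2011LMS] §1 and Def. 1.1; route file `Theses/PrintX8VSC.lean` (rev 2).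
-/

set_option autoImplicit false
-- justification: the mandated namespace `Summit.BirchSwinnertonDyer.BirchSwinnertonDyer.Theorems`
-- (single-conjunct summit, Sub = Summit) repeats a segment by design (D-0017).
set_option linter.dupNamespace false

noncomputable section

namespace Summit.BirchSwinnertonDyer.BirchSwinnertonDyer.Theorems.PrintX8VSCGlue

open scoped Classical NumberField MatrixGroups ModularForm
open NumberField IsDedekindDomain WeierstrassCurve CongruenceSubgroup
  Literature Literature.NumberTheory.EllipticCurves Literature.NumberTheory.EllipticCurves.ModularForms
  Literature.NumberTheory.EllipticCurves.Rank1Residual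
  Literature.NumberTheory.EllipticCurves.Rank1Residual.Typed
  Literature.NumberTheory.EllipticCurves.Sprung2017 Literature.NumberTheory.EllipticCurves.Sprung2012
  Literature.NumberTheory.EllipticCurves.BurungaleKobayashiOta2024
  Literature.NumberTheory.EllipticCurves.ZpExtension
  Summit.BirchSwinnertonDyer.BirchSwinnertonDyer.Theses.PrintX8VSC

/-! ### §1. Rank one per pair, print keying: Main Conj. 7.21 (all admissible colours, `X^•(γ⁻¹)`) ⟹ `BSD(E,3)` -/

/-- **X8 ∧ `r_an = 1`, ANY image, ANY conductor, PRINT KEYING: the body of `SharpFlatMainConjectureX8Contra` at `(W, 3)` (Sprung's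
Main Conjecture 7.21 at `η = 1` for every admissible colour, stated for the contragredient dual `X^•(γ⁻¹)`) gives Miller's `BSD(E,3)`**,
granted BY NAME the print-keyed ♯/♭ reading of Burungale–Kobayashi–Ota Cor. A.5 (`hBKO`), BCDT (`hmodf`), GZK and `hasEntireLFunction_rat`.
The admissible colour of the desk's per-pair reading `X8.bsdp_of_corA5_sharpFlat_contra` is discharged: the newform `f` of `W`, `3 ∤ N`
(`not_dvd_level_of_isNewformOf`), its Sprung pair (`thm112_exists_isSprungPair_holds`) and a colour with `L^• ≠ 0`
(`IsSprungPair.exists_chromaticL_ne_zero`). Conditional; closes nothing. [cite: BurungaleKobayashiOta2023, App. A Cor. A.5]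
[cite: Sprung2012, Prop. 6.14 (p. 1498), Prop. 7.19 and Main Conj. 7.21 (p. 1505), §7.5] [cite: Sprung2017, Thm. 1.12] [cite: Miller2011LMS, §1 and Def. 1.1] -/
theorem X8.bsdp_of_sprungSharpFlatMainConjectureContra_of_corA5Contra_of_analyticRank_eq_one
    (hBKO : corA5_pPart_of_sharpFlatCharIdeal_eq_contra) (hmodf : exists_isNewformOf)
    (hGZK : rank_eq_analyticRank_of_analyticRank_le_one) (hmod : hasEntireLFunction_rat)
    (W : WeierstrassCurve ℚ) [W.IsElliptic] [W.IsGloballyMinimal] (p : ℕ) [Fact p.Prime]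
    (hX : ClassX8 W p) (h1 : W.analyticRank = 1)
    (hMC : ∀ (col : Chroma) (κ : ZpExtension ℚ p) (γ : Field.absoluteGaloisGroup ℚ),
      κ.IsCyclotomic → κ.IsTopGenerator γ → IsCyclotomicVariable p γ →
      ∀ (v : HeightOneSpectrum (𝓞 ℚ)), (p : 𝓞 ℚ) ∈ v.asIdeal →
      ∀ (g : Field.absoluteGaloisGroup (v.adicCompletion ℚ)),
        κ.IsTopGenerator (resGalOfEmb (closureEmb (K := ℚ) (v.adicCompletion ℚ)) g) →
      ∀ (cneg : localPoints W (v.adicCompletion ℚ)) (c : ℕ → localPoints W (v.adicCompletion ℚ)),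
        IsHondaSystem κ (closureEmb (K := ℚ) (v.adicCompletion ℚ)) W (W.frobeniusTrace p) g cneg c →
      ∀ (N : ℕ) (_ : NeZero N) (f : CuspForm (Gamma0 N) 2) (ϖ : ℚ) (Lsharp Lflat : IwasawaAlgebra p),
        IsNewformOf W f → (ϖ : ℝ) * W.realPeriodRat = plusPeriod f →
        IsSprungPair f p (W.frobeniusTrace p) Lsharp Lflat → chromaticL col Lsharp Lflat ≠ 0 →
      ∀ (D : SharpFlatSelmerDualData W κ γ⁻¹ (closureEmb (K := ℚ) (v.adicCompletion ℚ))
          (W.frobeniusTrace p) g c col),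
        Module.IsTorsion (IwasawaAlgebra p) D.X ∧
        ∃ gen : IwasawaAlgebra p, D.charIdeal = Ideal.span {gen} ∧
          iwasawaToPowerSeries p gen =
            PowerSeries.C (ϖ : ℚ_[p]) * iwasawaToPowerSeries p (chromaticL col Lsharp Lflat)) :
    BSDp W p := by
  have hp3 : p = 3 := hX.1
  subst hp3
  have hgood : W.HasGoodReductionAtPrime 3 := hX.2.1.1
  have hdvd : ((3 : ℕ) : ℤ) ∣ W.frobeniusTrace 3 := hX.2.1.2
  haveI : NeZero (W.conductorNorm ℤ) := ⟨(W.conductorNorm_pos_holds).ne'⟩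
  obtain ⟨f, hf⟩ := hmodf W
  obtain ⟨Lsharp, Lflat, hSP⟩ :=
    thm112_exists_isSprungPair_holds (W := W) (f := f) (p := 3) (by decide) hf hgood hdvd
  obtain ⟨col, hcol⟩ := hSP.exists_chromaticL_ne_zero hf hgood
  exact BurungaleKobayashiOta2024.X8.bsdp_of_corA5_sharpFlat_contra W 3 hBKO hmod hGZK hX h1 col f
    (not_dvd_level_of_isNewformOf hf hgood) Lsharp Lflat hf hSP hcol (hMC col)

/-! ### §2. The route decl modulo the print-keyed BKO fact -/

/-- **Item stmt-BirchSwinnertonDyer-23745 `PrintX8VSC.RankOneLinkOfPrintX8Contra` MODULO ITS NAMED PUBLISHED FACT**: the print-keyed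
♯/♭ reading of Burungale–Kobayashi–Ota Cor. A.5 (`hBKO`) ⟹ (published bundle → GZK → print-keyed main conjecture on X8 at analytic rank
`≤ 1` → `Typed.MissingPPartAt W p` at every X8 pair of analytic rank `1`). Uses conjuncts 1 (`exists_isNewformOf`) and 7
(`hasEntireLFunction_rat`) of `PublishedInputsX8Contra`. CONDITIONAL on `hBKO` (statement-only fact); the item as born is not closed by
this — after the planner's route edit that displays the fact, the closer is `rankOneLinkOfPrintX8Contra_of_corA5Contra hBKO`.
[cite: BurungaleKobayashiOta2023, App. A Cor. A.5] [cite: Sprung2012, Main Conj. 7.21 (p. 1505), §7.5] [cite: Miller2011LMS, §1 and Def. 1.1] -/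
theorem rankOneLinkOfPrintX8Contra_of_corA5Contra (hBKO : corA5_pPart_of_sharpFlatCharIdeal_eq_contra) :
    RankOneLinkOfPrintX8Contra := by
  intro hPub hGZK hMC W _ _ p _ hX h1
  obtain ⟨hmodf, -, -, -, -, -, hmod⟩ := hPub
  unfold RankEqAnalyticRankLeOne at hGZK
  haveI : Finite W.sha := (hGZK W (by omega)).2
  exact missingPPartAt_of_bsdp W p
    (X8.bsdp_of_sprungSharpFlatMainConjectureContra_of_corA5Contra_of_analyticRank_eq_one hBKO hmodf hGZK hmod W p hX
      h1 (hMC W p hX (by omega)))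

end Summit.BirchSwinnertonDyer.BirchSwinnertonDyer.Theorems.PrintX8VSCGlue

end
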